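import Mathlib
import HarnessLib
import Summits.NavierStokesRegularity.NavierStokesRegularity.Theorems.TaylorModelRungThreeCertificateCoreStep
import Summits.NavierStokesRegularity.NavierStokesRegularity.Theorems.TaylorModelRungThreeCertificateFormatVBridge

/-!
# Crux K1b-DR (stmt-NavierStokesRegularity-23954), line `taylor-model` — v3 read-outs, K-SIDE part 3a: the BASE LANDING (R9)
# and the interval kernels of the landing family (typer g32; semantic clause (R9) of ns-tm-g4 g3's `…VReadoutsDefs` p625517,
# face formula cert-1 g2 `LANDING-R11-FORMULA-cert1.md` 1daf851c0a89d484 §(R9); composed by engine-1 g67)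

* `IntervalD.invPos` / `mem_invPos` — reciprocal of a positive interval (`[⌊2^p/hi.m⌋·2^(−p−hi.e), ⌈2^p/lo.m⌉·2^(−p−lo.e)]`);
  `signDef`, `absBox`, `mem_abs_absBox`, `absBox_lo_pos` — the absolute-value box of a sign-definite coordinate interval;
* `IntervalD.covMulIM` / `mem_covMulIM` — interval COVECTOR × MATRIX product (the rows of the (R11) bound, part 3b);
* `CertTables.landF` (the landing map as an explicit window function; `land_eq_landF : (T.toCertData φ).land j = T.landF (Lv (nx j))`),
  `idx_one_add`, `landNum`, `landOK`, `landBox` + **`mem_landF_landBox`** — every window coordinate of `land j y v`, for `y` in a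
  box with sign-definite `y_{i₀1}` and tails `|v i| ≤ tv`, lies in `Lv·[num_c]·[1/|y_{i₀1}|]`;
* `CertTables.testR9` / **`testR9_sound`** — (R9) per face `l < nF`: `mag(⟨W_l, Z⟩ − ctr_l) + β_l↑ + s_l↑ ≤ rad_l↓` implies
  `|covR φ (w l) z − ctr_l| + β_l ≤ rad_l − s_l` for every state `z` of the box `Z` (take `Z :=` the landing box of `Y⁰`).

HONEST FRAMING: kernel bookkeeping for the MODEL certificate №23954 (rung TL-M3); nothing here is a statement about the
Navier–Stokes equations.
-/

-- the sub-problem namespace repeats the summit name by design (D-0017)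
set_option linter.dupNamespace false

namespace Summit.NavierStokesRegularity.NavierStokesRegularity.Theorems.TaylorModelCert

open scoped BigOperators
open Set
open Literature.Analysis.FluidPDE.TaoCascade Literature.Analysis.FluidPDE.TaoCascade.TaylorChain
open Literature.Analysis.ValidatedNumerics

namespace IntervalD

variable {x : ℝ} {I : IntervalD}

/-! ### Reciprocal of a positive interval -/

/-- A dyadic with positive value has positive mantissa. [folklore] -/
theorem m_pos_of_toReal_pos {d : Dyad} (h : 0 < d.toReal) : 0 < d.m := by
  have h2 : (0 : ℝ) < (2 : ℝ) ^ d.e := zpow_pos (by norm_num) _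
  have : (0 : ℝ) < (d.m : ℝ) := (mul_pos_iff_of_pos_right h2).1 h
  exact_mod_cast this

/-- **Reciprocal of a positive interval** at relative precision `2^-prec`:
`[⌊2^p / hi.m⌋·2^(−p−hi.e), ⌈2^p / lo.m⌉·2^(−p−lo.e)]` (sound when `0 < lo`). [folklore] -/
def invPos (prec : ℕ) (I : IntervalD) : IntervalD :=
  ⟨⟨((2 ^ prec : ℕ) : ℤ) / I.hi.m, -(prec : ℤ) - I.hi.e⟩, ⟨Numerics.cdiv ((2 ^ prec : ℕ) : ℤ) I.lo.m, -(prec : ℤ) - I.lo.e⟩⟩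

/-- **Soundness of `invPos`**: `x ∈ I`, `0 < I.lo` ⇒ `x⁻¹ ∈ invPos I`. [folklore] -/
theorem mem_invPos (prec : ℕ) (hlo : 0 < I.lo.toReal) (hx : mem x I) : mem x⁻¹ (invPos prec I) := by
  obtain ⟨h1, h2⟩ := hx
  have hxpos : 0 < x := lt_of_lt_of_le hlo h1
  have hhi : 0 < I.hi.toReal := lt_of_lt_of_le hxpos h2
  have hmlo : (0 : ℤ) < I.lo.m := m_pos_of_toReal_pos hlo
  have hmhi : (0 : ℤ) < I.hi.m := m_pos_of_toReal_pos hhi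
  have h2e : ∀ e : ℤ, (0 : ℝ) < (2 : ℝ) ^ e := fun e => zpow_pos (by norm_num) _
  have hpow : ∀ e : ℤ, (2 : ℝ) ^ (-(prec : ℤ) - e) * (2 : ℝ) ^ e = (2 : ℝ) ^ (-(prec : ℤ)) := fun e => by
    rw [← zpow_add₀ (by norm_num : (2 : ℝ) ≠ 0)]; congr 1; ring
  have hone : (((2 ^ prec : ℕ) : ℤ) : ℝ) * (2 : ℝ) ^ (-(prec : ℤ)) = 1 := by
    push_cast
    rw [← zpow_natCast, ← zpow_add₀ (by norm_num : (2 : ℝ) ≠ 0), add_neg_cancel, zpow_zero]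
  have hfl := Numerics.fdiv_mul_le_real (a := ((2 ^ prec : ℕ) : ℤ)) hmhi
  have hce := Numerics.le_cdiv_mul_real (a := ((2 ^ prec : ℕ) : ℤ)) hmlo
  have hlo' : (0 : ℝ) < (I.lo.m : ℝ) * (2 : ℝ) ^ I.lo.e := by simpa [Dyad.toReal] using hlo
  have hhi' : (0 : ℝ) < (I.hi.m : ℝ) * (2 : ℝ) ^ I.hi.e := by simpa [Dyad.toReal] using hhi
  simp only [mem, invPos, Dyad.toReal] at h1 h2 ⊢
  constructor
  · have hL : ((((2 ^ prec : ℕ) : ℤ) / I.hi.m : ℤ) : ℝ) * (2 : ℝ) ^ (-(prec : ℤ) - I.hi.e) * ((I.hi.m : ℝ) * (2 : ℝ) ^ I.hi.e) ≤ 1 := by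
      calc ((((2 ^ prec : ℕ) : ℤ) / I.hi.m : ℤ) : ℝ) * (2 : ℝ) ^ (-(prec : ℤ) - I.hi.e) * ((I.hi.m : ℝ) * (2 : ℝ) ^ I.hi.e)
          = ((((2 ^ prec : ℕ) : ℤ) / I.hi.m : ℤ) : ℝ) * (I.hi.m : ℝ) * ((2 : ℝ) ^ (-(prec : ℤ) - I.hi.e) * (2 : ℝ) ^ I.hi.e) := by ring
        _ ≤ (((2 ^ prec : ℕ) : ℤ) : ℝ) * (2 : ℝ) ^ (-(prec : ℤ)) := by
            rw [hpow]; exact mul_le_mul_of_nonneg_right hfl (h2e _).le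
        _ = 1 := hone
    calc ((((2 ^ prec : ℕ) : ℤ) / I.hi.m : ℤ) : ℝ) * (2 : ℝ) ^ (-(prec : ℤ) - I.hi.e)
        ≤ ((I.hi.m : ℝ) * (2 : ℝ) ^ I.hi.e)⁻¹ := by rw [← one_div, le_div_iff₀ hhi']; exact hL
      _ ≤ x⁻¹ := inv_anti₀ hxpos h2
  · have hU : 1 ≤ ((Numerics.cdiv ((2 ^ prec : ℕ) : ℤ) I.lo.m : ℤ) : ℝ) * (2 : ℝ) ^ (-(prec : ℤ) - I.lo.e) * ((I.lo.m : ℝ) * (2 : ℝ) ^ I.lo.e) := by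
      calc (1 : ℝ) = (((2 ^ prec : ℕ) : ℤ) : ℝ) * (2 : ℝ) ^ (-(prec : ℤ)) := hone.symm
        _ ≤ ((Numerics.cdiv ((2 ^ prec : ℕ) : ℤ) I.lo.m : ℤ) : ℝ) * (I.lo.m : ℝ) * (2 : ℝ) ^ (-(prec : ℤ)) :=
            mul_le_mul_of_nonneg_right hce (h2e _).le
        _ = ((Numerics.cdiv ((2 ^ prec : ℕ) : ℤ) I.lo.m : ℤ) : ℝ) * (2 : ℝ) ^ (-(prec : ℤ) - I.lo.e) * ((I.lo.m : ℝ) * (2 : ℝ) ^ I.lo.e) := by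
            rw [← hpow I.lo.e]; ring
    calc x⁻¹ ≤ ((I.lo.m : ℝ) * (2 : ℝ) ^ I.lo.e)⁻¹ := inv_anti₀ hlo' h1
      _ ≤ ((Numerics.cdiv ((2 ^ prec : ℕ) : ℤ) I.lo.m : ℤ) : ℝ) * (2 : ℝ) ^ (-(prec : ℤ) - I.lo.e) := by
          rw [← one_div, div_le_iff₀ hlo']; exact hU

/-! ### Sign-definite coordinate intervals -/

/-- `0 < lo` (the interval is positive). [folklore] -/
def posLo (I : IntervalD) : Bool := Dyad.blt (Dyad.ofInt 0) I.lo

/-- `hi < 0` (the interval is negative). [folklore] -/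
def negHi (I : IntervalD) : Bool := Dyad.blt I.hi (Dyad.ofInt 0)

/-- Sign-definite: positive or negative. [folklore] -/
def signDef (I : IntervalD) : Bool := posLo I || negHi I

/-- The box of `|x|` for a sign-definite `I ∋ x`: `I` itself if positive, `−I` otherwise. [folklore] -/
def absBox (I : IntervalD) : IntervalD := if posLo I then I else neg I

/-- [folklore] -/
theorem mem_abs_absBox (hs : signDef I = true) (hx : mem x I) : mem |x| (absBox I) := by
  unfold absBox
  by_cases hp : posLo I = true
  · rw [if_pos hp]
    have h0 : 0 < I.lo.toReal := by simpa [posLo, Dyad.blt_iff] using hp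
    rwa [abs_of_pos (lt_of_lt_of_le h0 hx.1)]
  · rw [if_neg hp]
    have hn : negHi I = true := by simpa [signDef, hp] using hs
    have h0 : I.hi.toReal < 0 := by simpa [negHi, Dyad.blt_iff] using hn
    rw [abs_of_neg (lt_of_le_of_lt hx.2 h0)]
    exact mem_neg hx

/-- [folklore] -/
theorem absBox_lo_pos (hs : signDef I = true) : 0 < (absBox I).lo.toReal := by
  unfold absBox
  by_cases hp : posLo I = true
  · rw [if_pos hp]; simpa [posLo, Dyad.blt_iff] using hp
  · rw [if_neg hp]
    have hn : negHi I = true := by simpa [signDef, hp] using hs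
    have h0 : I.hi.toReal < 0 := by simpa [negHi, Dyad.blt_iff] using hn
    simp only [neg, Dyad.toReal_neg]; linarith

/-! ### Covector × matrix -/

/-- Rounded interval COVECTOR × MATRIX product: `(W·M)_c = Σ_{r<n} W[r]·M[r][c]`. [folklore] -/
def covMulIM (n prec : ℕ) (W : Array IntervalD) (M : Array (Array IntervalD)) : Array IntervalD :=
  Array.ofFn fun c : Fin n => rangeSumR prec (fun r => mulR prec (aget W r) (imget M r c)) n

/-- Soundness of `covMulIM`. [folklore] -/
theorem mem_covMulIM {n : ℕ} (prec : ℕ) {W : Array IntervalD} {M : Array (Array IntervalD)} {w : ℕ → ℝ} {a : ℕ → ℕ → ℝ}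
    (hw : ∀ r < n, mem (w r) (aget W r)) (ha : MemMat n a M) {c : ℕ} (hc : c < n) :
    mem (∑ r ∈ Finset.range n, w r * a r c) (aget (covMulIM n prec W M) c) := by
  unfold covMulIM; rw [aget_ofFn _ hc]
  exact mem_rangeSumR prec n fun r hr => mem_mulR prec (hw r hr) (ha r hr c hc)

end IntervalD

namespace CertTables

variable {K : Type} [Field K] {φ : K →+* ℝ} (T : CertTables K)

/-! ### The landing map over a box -/

/-- The landing map as an explicit window function of the factor `Lv` (`= CertData.land`, `land_eq_landF`). [folklore] -/
noncomputable def landF (Lv : ℝ) (y : Fin 4 → ℤ → ℝ) (v : Fin 4 → ℝ) : Fin 4 → ℤ → ℝ :=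
  fun i k => Lv * (if k + 1 ≤ T.Ka then y i (1 + k) else v i) / |y T.i₀ 1|

/-- `CertData.land` of the presented record is `landF` at `Lv (nx j)`. [folklore] -/
theorem land_eq_landF (j : ℕ) : (T.toCertData φ).land j = T.landF ((T.toCertData φ).Lv ((T.toCertData φ).nx j)) := rfl

omit [Field K] in
/-- The next shell of a window coordinate is the next coordinate. [folklore] -/
theorem idx_one_add (i : Fin 4) {k : ℤ} (hk : -T.Kb ≤ k) : T.idx i (1 + k) = T.idx i k + 1 := by
  unfold idx; omega

/-- Numerator box of the landing map at window coordinate `c`: the next coordinate's interval, or the tail box `±tv` on the top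
shell. [folklore] -/
def landNum (tv : Dyad) (Y : Array IntervalD) (c : ℕ) : IntervalD :=
  if T.wk c + 1 ≤ T.Ka then IntervalD.aget Y (c + 1) else IntervalD.symBox tv

/-- Structural test for the landing box: shell `1` in the window and `y_{i₀1}` sign-definite over the box. [folklore] -/
def landOK (Y : Array IntervalD) : Bool :=
  decide (-T.Kb ≤ 1 ∧ (1 : ℤ) ≤ T.Ka) && IntervalD.signDef (IntervalD.aget Y (T.idx T.i₀ 1))

/-- **The landing box**: coordinate `c ↦ LvB·[num_c]·[1/|y_{i₀1}|]`. [folklore] -/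
def landBox (prec : ℕ) (LvB : IntervalD) (tv : Dyad) (Y : Array IntervalD) : Array IntervalD :=
  let R := IntervalD.invPos prec (IntervalD.absBox (IntervalD.aget Y (T.idx T.i₀ 1)))
  Array.ofFn fun c : Fin T.n => IntervalD.mulR prec (IntervalD.mulR prec LvB (T.landNum tv Y c)) R

omit [Field K] in
/-- **Soundness of the landing box**: for `y` in the box `Y` (window values), tails `|v i| ≤ tv`, `Lv ∈ LvB`, and `landOK Y`,
every window coordinate of `landF Lv y v` lies in `landBox`. [folklore] -/
theorem mem_landF_landBox {Y : Array IntervalD} (hok : T.landOK Y = true) (prec : ℕ) {Lv : ℝ} {LvB : IntervalD}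
    (hLv : IntervalD.mem Lv LvB) {tv : Dyad} {v : Fin 4 → ℝ} (hv : ∀ i, |v i| ≤ tv.toReal)
    {y : Fin 4 → ℤ → ℝ} (hy : MemVec T.n (T.wv y) Y) :
    MemVec T.n (T.wv (T.landF Lv y v)) (T.landBox prec LvB tv Y) := by
  simp only [landOK, Bool.and_eq_true, decide_eq_true_eq] at hok
  obtain ⟨h1, hsd⟩ := hok
  intro c hc
  have hk := T.InW_wk hc
  -- the reciprocal factor
  have hy0 : IntervalD.mem (y T.i₀ 1) (IntervalD.aget Y (T.idx T.i₀ 1)) := by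
    have := hy (T.idx T.i₀ 1) (T.idx_lt_n T.i₀ h1); rwa [T.wv_idx y T.i₀ h1] at this
  have habs := IntervalD.mem_abs_absBox hsd hy0
  have hR := IntervalD.mem_invPos prec (IntervalD.absBox_lo_pos hsd) habs
  -- the numerator
  have hnum : IntervalD.mem (if T.wk c + 1 ≤ T.Ka then y (T.wi c) (1 + T.wk c) else v (T.wi c)) (T.landNum tv Y c) := by
    unfold landNum
    by_cases hK : T.wk c + 1 ≤ T.Ka
    · rw [if_pos hK, if_pos hK]
      have hk' : -T.Kb ≤ 1 + T.wk c ∧ 1 + T.wk c ≤ T.Ka := ⟨by linarith [hk.1], by linarith⟩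
      have := hy (T.idx (T.wi c) (1 + T.wk c)) (T.idx_lt_n _ hk')
      rw [T.wv_idx y _ hk', T.idx_one_add _ hk.1, T.idx_wi_wk hc] at this
      exact this
    · rw [if_neg hK, if_neg hK]
      exact IntervalD.mem_symBox (hv _)
  have hprod := IntervalD.mem_mulR prec (IntervalD.mem_mulR prec hLv hnum) hR
  unfold landBox
  rw [IntervalD.aget_ofFn _ hc]
  have hval : T.wv (T.landF Lv y v) c = Lv * (if T.wk c + 1 ≤ T.Ka then y (T.wi c) (1 + T.wk c) else v (T.wi c)) * |y T.i₀ 1|⁻¹ := by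
    simp only [wv, landF, div_eq_mul_inv]
  rw [hval]
  exact hprod

/-! ### (R9) the base landing, per face -/

/-- **(R9) TEST** per face `l < nF`: `mag(⟨W_l, Z⟩ − ctr_l) + β_l.hi + s_l.hi ≤ rad_l.lo`. [folklore] -/
def testR9 (prec nF : ℕ) (W : Array (Array IntervalD)) (Z : Array IntervalD) (ctrB βB sB radB : Array IntervalD) : Bool :=
  allN nF fun l =>
    Dyad.ble
      (Dyad.add (Dyad.add
        (IntervalD.mag (IntervalD.subR prec
          (IntervalD.rangeSumR prec (fun c => IntervalD.mulR prec (IntervalD.aget (IntervalD.lget W l) c) (IntervalD.aget Z c)) T.n)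
          (IntervalD.aget ctrB l)))
        (IntervalD.aget βB l).hi) (IntervalD.aget sB l).hi)
      (IntervalD.aget radB l).lo

/-- **Soundness of (R9)**: with face-coefficient enclosures `φ (w l)_c ∈ W[l][c]`, scalar enclosures `ctr_l ∈ ctrB[l]`, `β_l ∈ βB[l]`,
`s_l ∈ sB[l]`, `rad_l ∈ radB[l]`, every state `z` of the box `Z` satisfies `|covR φ (w l) z − ctr_l| + β_l ≤ rad_l − s_l` for every
face `l < nF`. [folklore] -/
theorem testR9_sound {prec nF : ℕ} {W : Array (Array IntervalD)} {Z : Array IntervalD} {ctrB βB sB radB : Array IntervalD}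
    (h : T.testR9 prec nF W Z ctrB βB sB radB = true)
    {w : ℕ → List K} (hW : ∀ l < nF, ∀ c < T.n, IntervalD.mem (φ (vget (w l) c)) (IntervalD.aget (IntervalD.lget W l) c))
    {ctr β s rad : ℕ → ℝ} (hctr : ∀ l < nF, IntervalD.mem (ctr l) (IntervalD.aget ctrB l))
    (hβ : ∀ l < nF, IntervalD.mem (β l) (IntervalD.aget βB l)) (hs : ∀ l < nF, IntervalD.mem (s l) (IntervalD.aget sB l))
    (hrad : ∀ l < nF, IntervalD.mem (rad l) (IntervalD.aget radB l))
    {z : Fin 4 → ℤ → ℝ} (hz : MemVec T.n (T.wv z) Z) {l : ℕ} (hl : l < nF) :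
    |T.covR φ (w l) z - ctr l| + β l ≤ rad l - s l := by
  have hb := (allN_eq_true.1 h) l hl
  simp only [Dyad.ble_iff, Dyad.toReal_add] at hb
  have hdot : IntervalD.mem (T.covR φ (w l) z)
      (IntervalD.rangeSumR prec (fun c => IntervalD.mulR prec (IntervalD.aget (IntervalD.lget W l) c) (IntervalD.aget Z c)) T.n) := by
    rw [T.covR_apply φ (w l) z]
    exact IntervalD.mem_rangeSumR prec T.n fun c hc => IntervalD.mem_mulR prec (hW l hl c hc) (hz c hc)
  have hmag := IntervalD.abs_le_mag (IntervalD.mem_subR prec hdot (hctr l hl))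
  linarith [(hβ l hl).2, (hs l hl).2, (hrad l hl).1]

end CertTables

end Summit.NavierStokesRegularity.NavierStokesRegularity.Theorems.TaylorModelCert
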